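import Mathlib
import Summits.NavierStokesRegularity.NavierStokesRegularity.Theorems.EulerZoomLiouvillePowerGaugeEulerLiouvilleDriftClockInvariant
import HarnessLib

/-!
# Line `action_creep` (ns-idea-11 g8), stub AC1 `stub_creepingMaximisers`: BOUNDED VORTICAL BERNOULLI LEVELS ⇒ CREEPING NEAR-MAXIMISERS
# (crux `EulerZoomLiouville.PowerGaugeEulerLiouville` = stmt-NavierStokesRegularity-19832; class-free ODE lemma on `C²` profiles; width seat ns-ezl-w3 g6)

Route №10 `EulerZoomLiouville` (NavierStokesRegularity), crux E; line `Cruxes/PowerGaugeEulerLiouville/Lines/action_creep.lean` (LINE g8-1).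
`(V, P′)` a `C²` self-similar Euler profile (CIV (3.3)) at rate `γ = 1/(2+ρ) ∈ (0, ½)`, `W = γy + V` its backward transport field,
`ℋ = ½|W|² + P′ + ½γ(γ−1)|y|²` its Bernoulli function, `Mb` an upper bound of `ℋ` on the vortical set that is approached by vortical values.
THEN (`ActionCreep.creepingMaximisers` = `Sig.stub_creepingMaximisers` VERBATIM): for every `δ > 0` and every radius `R₀` there is a VORTICAL point
`y` with `‖y‖ ≥ R₀`, `ℋ(y) > Mb − δ` which HOVERS: `‖W(y)‖ ≤ δ`.

PROOF — the ACTION BUDGET of a near-maximal label, run on a FINITE backward arc (no global orbits, no Cauchy–Schwarz): with `δ′ = min(δ, (1−2γ)δ)`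
pick a vortical `x` with `ℋ(x) > Mb − δ′` and a nearby `x̃` (the set `{curl ≠ 0, ℋ > Mb − δ′, ‖·‖ < R_in}` is open and non-empty, hence of
positive volume) OFF the null set of vortical points with a confined backward orbit (`Loc.volume_vortical_confined_eq_zero`, `N = R_out = R_in + 2`,
`R_in ≥ max(R₀, 0) + ‖x‖ + 1`).  The backward orbit `Y` of the cut-off field (`Loc.exists_cutoff_local` at `R_out + 1`, flow `C2.Kelvin.hasDerivAt_flow_neg`)
from `x̃` reaches `‖·‖ = R_out` (else it is a CONFINED TRUE orbit), first at `σ₁` (`ChannelClock.exists_first_hit`); on `[0, σ₁]` it is a true `W`-arc,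
VORTICAL throughout (Cauchy/Grönwall transport, `ActionCreep.curl_ne_zero_of_arc` = `OutflowDive.vorticityTransport` with its idle binder `ρ ≤ ½` removed),
so `ℋ(Y t) ≤ Mb`, and by the arc form of CIV (3.31) (`ActionCreep.bernoulli_arc`) the ACTION `(1−2γ)∫₀^{σ₁}‖W(Y)‖² = ℋ(Yσ₁) − ℋ(x̃) < δ′`.  The last
crossing `t_a` of `‖·‖ = R_in + 1` before `σ₁` (first hit of the reversed arc) bounds an excursion `[t_a, σ₁]` beyond `R_in + 1` of LENGTH `≥ 1 ≤ ∫‖W(Y)‖`;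
with `m = min_{[t_a,σ₁]}‖W(Y)‖`: `m ≤ m∫‖W(Y)‖ ≤ ∫‖W(Y)‖² < δ′/(1−2γ) ≤ δ`, and the minimiser `y = Y(t⋆)` is the creeping point.

WHAT THIS IS NOT: not NS regularity, not the crux E, not the line's open faces AC2/AC3 — a class-free lemma about `C²` profiles (MODEL lattice),
`--supports` stmt-19832; 19832 OPEN. [folklore; ConstantinIgnatovaVicol2026Putative §3.4.3 (3.31)]
-/

noncomputable section

-- flat `Theorems/<Route><Decl>…` files of one crux share the namespace of the crux (tree convention: `Summit.<S>.<S>.…`)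
set_option linter.dupNamespace false

open Set Filter Topology Metric MeasureTheory
open scoped RealInnerProductSpace ENNReal

namespace Summit.NavierStokesRegularity.NavierStokesRegularity.Theorems.PowerGaugeEulerLiouville

namespace ActionCreep

open Literature.Analysis Literature.Analysis.FluidPDE
open ChannelClock

variable {γ : ℝ} {V : EuclideanSpace ℝ (Fin 3) → EuclideanSpace ℝ (Fin 3)} {P' : EuclideanSpace ℝ (Fin 3) → ℝ}

/-! ### Vorticity and Bernoulli along a finite backward arc -/

/-- **Vorticity is transported along backward arcs** (Cauchy formula read through Grönwall): if `Y′ = −W(Y)` on `[0, σ₁]` and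
`curl V (Y 0) ≠ 0` then `curl V (Y σ₁) ≠ 0`.  Every `γ` (the tree's `OutflowDive.vorticityTransport` carries an idle `ρ ≤ ½`). [folklore] -/
theorem curl_ne_zero_of_arc (hprof : IsSelfSimilarEulerProfile γ 0 V P') {σ₁ : ℝ} (hσ₁ : 0 ≤ σ₁)
    {Y : ℝ → EuclideanSpace ℝ (Fin 3)} (hY : ∀ σ ∈ Icc 0 σ₁, HasDerivAt Y (-(selfSimilarTransport γ 0 V (Y σ))) σ)
    (hΩ0 : curl V (Y 0) ≠ 0) : curl V (Y σ₁) ≠ 0 := by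
  -- adapted from the tree's `OutflowDive.vorticityTransport` (ns-ezl-w1), binder `ρ ≤ 1/2` dropped
  intro hΩ1
  apply hΩ0
  set W : EuclideanSpace ℝ (Fin 3) → EuclideanSpace ℝ (Fin 3) := selfSimilarTransport γ 0 V with hWdef
  set Ω : EuclideanSpace ℝ (Fin 3) → EuclideanSpace ℝ (Fin 3) := curl V with hΩdef
  have hV2 : ContDiff ℝ 2 V := hprof.contDiff_velocity
  have hΩd : Differentiable ℝ Ω := differentiable_curl_of_contDiff hV2
  have hvort := hprof.isSelfSimilarEulerVorticityProfile
  have htr : ∀ y, fderiv ℝ Ω y (W y) = fderiv ℝ V y (Ω y) - Ω y := fun y => by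
    have e := hvort.vorticity_eq_transport y
    rw [← e]; simp [hΩdef, hWdef]
  have hYc : ContinuousOn Y (Icc 0 σ₁) := fun σ hσ => (hY σ hσ).continuousAt.continuousWithinAt
  have hDVc : Continuous fun y => fderiv ℝ V y := hV2.continuous_fderiv (by norm_num)
  obtain ⟨K, hK⟩ := (isCompact_Icc (a := (0 : ℝ)) (b := σ₁)).exists_bound_of_continuousOn
    ((hDVc.comp_continuousOn hYc).norm)
  set g : ℝ → EuclideanSpace ℝ (Fin 3) := fun s => Ω (Y (σ₁ - s)) with hgdef
  set g' : ℝ → EuclideanSpace ℝ (Fin 3) := fun s =>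
    fderiv ℝ V (Y (σ₁ - s)) (Ω (Y (σ₁ - s))) - Ω (Y (σ₁ - s)) with hg'def
  have hmem : ∀ s ∈ Icc (0 : ℝ) σ₁, σ₁ - s ∈ Icc (0 : ℝ) σ₁ := fun s hs =>
    ⟨by linarith [hs.2], by linarith [hs.1]⟩
  have hgd : ∀ s ∈ Icc (0 : ℝ) σ₁, HasDerivAt g (g' s) s := by
    intro s hs
    have hYs := hY (σ₁ - s) (hmem s hs)
    have hZ : HasDerivAt (fun σ => Ω (Y σ)) (fderiv ℝ Ω (Y (σ₁ - s)) (-(W (Y (σ₁ - s))))) (σ₁ - s) :=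
      (hΩd (Y (σ₁ - s))).hasFDerivAt.comp_hasDerivAt (σ₁ - s) hYs
    have hrev : HasDerivAt (fun s : ℝ => σ₁ - s) (-1 : ℝ) s := by
      simpa using (hasDerivAt_id s).const_sub σ₁
    have hcomp := hZ.scomp s hrev
    refine hcomp.congr_deriv ?_
    rw [map_neg, htr]
    simp only [hg'def, smul_neg, neg_smul, one_smul, smul_sub]
    abel
  have hgc : ContinuousOn g (Icc 0 σ₁) := fun s hs => (hgd s hs).continuousAt.continuousWithinAt
  have hbound : ∀ s ∈ Ico (0 : ℝ) σ₁, ‖g' s‖ ≤ (K + 1) * ‖g s‖ + 0 := by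
    intro s hs
    have hs' : s ∈ Icc (0 : ℝ) σ₁ := Ico_subset_Icc_self hs
    have hKs := hK (σ₁ - s) (hmem s hs')
    simp only [Function.comp, norm_norm] at hKs
    rw [add_zero, hg'def]
    calc ‖fderiv ℝ V (Y (σ₁ - s)) (Ω (Y (σ₁ - s))) - Ω (Y (σ₁ - s))‖
        ≤ ‖fderiv ℝ V (Y (σ₁ - s)) (Ω (Y (σ₁ - s)))‖ + ‖Ω (Y (σ₁ - s))‖ := norm_sub_le _ _
      _ ≤ ‖fderiv ℝ V (Y (σ₁ - s))‖ * ‖Ω (Y (σ₁ - s))‖ + ‖Ω (Y (σ₁ - s))‖ := by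
          gcongr; exact ContinuousLinearMap.le_opNorm _ _
      _ ≤ K * ‖Ω (Y (σ₁ - s))‖ + ‖Ω (Y (σ₁ - s))‖ := by gcongr
      _ = (K + 1) * ‖g s‖ := by rw [hgdef]; ring
  have h0 : ‖g 0‖ ≤ 0 := by
    rw [hgdef]
    simp only [sub_zero]
    rw [show Ω (Y σ₁) = 0 from hΩ1, norm_zero]
  have hgron := norm_le_gronwallBound_of_norm_deriv_right_le hgc (fun s hs => (hgd s (Ico_subset_Icc_self hs)).hasDerivWithinAt)
    h0 hbound σ₁ (right_mem_Icc.2 hσ₁)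
  rw [gronwallBound_ε0_δ0] at hgron
  have : g σ₁ = 0 := norm_le_zero_iff.1 hgron
  simpa [hgdef] using this

/-- **CIV (3.31) on a finite backward arc**: if `Y′ = −W(Y)` on `[0, B]`, then for `0 ≤ a ≤ b ≤ B`,
`ℋ(Y b) − ℋ(Y a) = (1 − 2γ) ∫_a^b ‖W(Y t)‖² dt` (the tree's `HalfOrbit.bernoulli_comp_sub_eq_of_Ici` asks for the ODE on all of `[0, ∞)`).
[cite-free restatement of ConstantinIgnatovaVicol2026Putative (3.31); folklore] -/
theorem bernoulli_arc (hprof : IsSelfSimilarEulerProfile γ 0 V P') {B : ℝ}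
    {Y : ℝ → EuclideanSpace ℝ (Fin 3)} (hY : ∀ σ ∈ Icc 0 B, HasDerivAt Y (-(selfSimilarTransport γ 0 V (Y σ))) σ)
    {a b : ℝ} (ha : 0 ≤ a) (hab : a ≤ b) (hbB : b ≤ B) :
    selfSimilarBernoulli γ 0 V P' (Y b) - selfSimilarBernoulli γ 0 V P' (Y a) =
      (1 - 2 * γ) * ∫ t in a..b, ‖selfSimilarTransport γ 0 V (Y t)‖ ^ 2 := by
  have hWc : Continuous (selfSimilarTransport γ 0 V) := by
    have e : selfSimilarTransport γ 0 V = fun y => γ • (y - 0) + V y := rfl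
    rw [e]; exact ((continuous_id.sub continuous_const).const_smul γ).add hprof.contDiff_velocity.continuous
  have hYc : ContinuousOn Y (Icc a b) := fun t ht =>
    (hY t ⟨ha.trans ht.1, ht.2.trans hbB⟩).continuousAt.continuousWithinAt
  have hHd : Differentiable ℝ (selfSimilarBernoulli γ 0 V P') :=
    hprof.contDiff_selfSimilarBernoulli.differentiable one_ne_zero
  have hder : ∀ t ∈ uIcc a b, HasDerivAt (fun s => selfSimilarBernoulli γ 0 V P' (Y s))
      ((1 - 2 * γ) * ‖selfSimilarTransport γ 0 V (Y t)‖ ^ 2) t := by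
    intro t ht
    rw [uIcc_of_le hab] at ht
    have hYt := hY t ⟨ha.trans ht.1, ht.2.trans hbB⟩
    have h1 : HasDerivAt (fun s => selfSimilarBernoulli γ 0 V P' (Y s))
        (fderiv ℝ (selfSimilarBernoulli γ 0 V P') (Y t) (-(selfSimilarTransport γ 0 V (Y t)))) t :=
      (hHd (Y t)).hasFDerivAt.comp_hasDerivAt t hYt
    rw [map_neg, hprof.fderiv_selfSimilarBernoulli_transport (Y t)] at h1
    refine h1.congr_deriv ?_
    ring
  have hcont : ContinuousOn (fun t => (1 - 2 * γ) * ‖selfSimilarTransport γ 0 V (Y t)‖ ^ 2) (uIcc a b) := by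
    rw [uIcc_of_le hab]
    exact continuousOn_const.mul ((hWc.comp_continuousOn hYc).norm.pow 2)
  have key := intervalIntegral.integral_eq_sub_of_hasDerivAt hder (hcont.intervalIntegrable)
  rw [← key, intervalIntegral.integral_const_mul]

/-! ### The stub -/

set_option maxHeartbeats 400000 in
/-- **AC1 `stub_creepingMaximisers` OF LINE `action_creep`** (`Sig.stub_creepingMaximisers` VERBATIM, Literature names, `E3` spelled out):
`(V, P′)` a `C²` self-similar Euler profile at rate `γ = 1/(2+ρ)`, `ρ > 0`; `Mb` an upper bound of `ℋ` on the vortical set that is approached by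
vortical values.  Then for every `δ > 0` and radius `R₀` there is a vortical `y` with `‖y‖ ≥ R₀`, `ℋ(y) > Mb − δ` and `‖γy + V y‖ ≤ δ`
— CANONICAL CREEPING CELLS in the bounded branch `M_∞ < ∞`.  Proof in the module docstring (finite-arc action budget).
[folklore; ConstantinIgnatovaVicol2026Putative §3.4.3 (3.31)] -/
theorem creepingMaximisers :
    ∀ ρ : ℝ, 0 < ρ →
    ∀ (V : EuclideanSpace ℝ (Fin 3) → EuclideanSpace ℝ (Fin 3)) (P' : EuclideanSpace ℝ (Fin 3) → ℝ),
      IsSelfSimilarEulerProfile (1 / (2 + ρ)) 0 V P' →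
      ∀ Mb : ℝ,
        (∀ y : EuclideanSpace ℝ (Fin 3), curl V y ≠ 0 → selfSimilarBernoulli (1 / (2 + ρ)) 0 V P' y ≤ Mb) →
        (∀ δ : ℝ, 0 < δ → ∃ x : EuclideanSpace ℝ (Fin 3), curl V x ≠ 0 ∧
            Mb - δ < selfSimilarBernoulli (1 / (2 + ρ)) 0 V P' x) →
        ∀ δ : ℝ, 0 < δ → ∀ R₀ : ℝ, ∃ y : EuclideanSpace ℝ (Fin 3), R₀ ≤ ‖y‖ ∧ curl V y ≠ 0 ∧
          Mb - δ < selfSimilarBernoulli (1 / (2 + ρ)) 0 V P' y ∧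
          ‖selfSimilarTransport (1 / (2 + ρ)) 0 V y‖ ≤ δ := by
  intro ρ hρ V P' hprof Mb hMb happ δ hδ R₀
  set γ : ℝ := 1 / (2 + ρ) with hγdef
  have h2ρ : (0 : ℝ) < 2 + ρ := by linarith
  have hγ : 0 < γ := one_div_pos.2 h2ρ
  have hγ2 : γ < 1 / 2 := one_div_lt_one_div_of_lt two_pos (by linarith)
  have h12 : 0 < 1 - 2 * γ := by linarith
  set W : EuclideanSpace ℝ (Fin 3) → EuclideanSpace ℝ (Fin 3) := selfSimilarTransport γ 0 V with hWdef
  set ℋ : EuclideanSpace ℝ (Fin 3) → ℝ := selfSimilarBernoulli γ 0 V P' with hHdef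
  have hU2 : ContDiff ℝ 2 V := hprof.contDiff_velocity
  have hWc : Continuous W := by
    have e : W = fun y => γ • (y - 0) + V y := rfl
    rw [e]; exact ((continuous_id.sub continuous_const).const_smul γ).add hU2.continuous
  have hHc : Continuous ℋ := hprof.contDiff_selfSimilarBernoulli.continuous
  have hcurlc : Continuous (curl V) := (differentiable_curl_of_contDiff hU2).continuous
  -- ### the tolerance `δ′` and a near-maximal vortical point
  set δ' : ℝ := min δ ((1 - 2 * γ) * δ) with hδ'def
  have hδ' : 0 < δ' := lt_min hδ (mul_pos h12 hδ)
  have hδ'δ : δ' ≤ δ := min_le_left _ _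
  have hδ'2 : δ' ≤ (1 - 2 * γ) * δ := min_le_right _ _
  obtain ⟨x, hxc, hxH⟩ := happ δ' hδ'
  -- ### radii
  set Rin : ℝ := max R₀ 0 + ‖x‖ + 1 with hRindef
  have hRin0 : 0 < Rin := by rw [hRindef]; linarith [le_max_right R₀ 0, norm_nonneg x]
  have hxRin : ‖x‖ < Rin := by rw [hRindef]; linarith [le_max_right R₀ 0]
  have hR₀Rin : R₀ ≤ Rin := by rw [hRindef]; linarith [le_max_left R₀ 0, norm_nonneg x]
  set Rout : ℝ := Rin + 2 with hRoutdef
  have hRout0 : 0 < Rout := by rw [hRoutdef]; linarith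
  -- ### a good starting label: near-maximal, vortical, inside `B(0, R_in)`, backward orbit NOT confined to `‖·‖ ≤ R_out`
  set O : Set (EuclideanSpace ℝ (Fin 3)) := {z | curl V z ≠ 0 ∧ Mb - δ' < ℋ z ∧ ‖z‖ < Rin} with hOdef
  have hOopen : IsOpen O :=
    (isOpen_ne_fun hcurlc continuous_const).inter ((isOpen_lt continuous_const hHc).inter (isOpen_lt continuous_norm continuous_const))
  have hxO : x ∈ O := ⟨hxc, hxH, hxRin⟩
  have hOpos : 0 < volume O := hOopen.measure_pos volume ⟨x, hxO⟩
  have hnull := Loc.volume_vortical_confined_eq_zero hprof hγ hγ2 hRout0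
  obtain ⟨x₁, hx₁O, hx₁good⟩ : ∃ z ∈ O, z ∉ {x : EuclideanSpace ℝ (Fin 3) | curl V x ≠ 0 ∧
      ∃ Y : ℝ → EuclideanSpace ℝ (Fin 3), Y 0 = x ∧
        (∀ t, 0 ≤ t → HasDerivAt Y ((-1 : ℝ) • selfSimilarTransport γ 0 V (Y t)) t) ∧
        ∀ t, 0 ≤ t → ‖Y t‖ ≤ Rout} := by
    by_contra hcon
    push Not at hcon
    have hle := measure_mono (μ := volume) (show O ⊆ _ from fun z hz => hcon z hz)
    rw [hnull] at hle
    exact absurd (le_antisymm hle bot_le) hOpos.ne'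
  obtain ⟨hx₁c, hx₁H, hx₁Rin⟩ := hx₁O
  -- ### the cut-off flow and the backward orbit from `x₁`
  obtain ⟨V₀, hV₀, -, -, ⟨K₀, hK₀⟩, hagree⟩ := Loc.exists_cutoff_local hU2 (R := Rout + 1) (by linarith)
  have hV₀1 : ContDiff ℝ 1 V₀ := hV₀.of_le (by norm_num)
  have hWeq : ∀ z : EuclideanSpace ℝ (Fin 3), ‖z‖ < Rout + 1 → selfSimilarTransport γ 0 V₀ z = W z := by
    intro z hz
    simp only [hWdef, selfSimilarTransport_apply, hagree z (by rwa [mem_ball, dist_zero_right])]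
  set Φ := ODE.evolutionMap (fun _ : ℝ => selfSimilarTransport γ 0 V₀) 0 with hΦdef
  set Y : ℝ → EuclideanSpace ℝ (Fin 3) := fun t => Φ (-t) x₁ with hYdef
  have hYd : ∀ t, HasDerivAt Y ((-1 : ℝ) • selfSimilarTransport γ 0 V₀ (Y t)) t :=
    fun t => C2.Kelvin.hasDerivAt_flow_neg (γ := γ) hV₀1 hK₀ x₁ t
  have hYc : Continuous Y := continuous_iff_continuousAt.2 fun t => (hYd t).continuousAt
  have hY0 : Y 0 = x₁ := by simp [hYdef, hΦdef, ODE.evolutionMap_self]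
  -- the orbit reaches `‖·‖ = R_out` (else it is a confined TRUE orbit and `x₁` would be bad)
  have hreach : ∃ σ : ℝ, 0 ≤ σ ∧ Rout ≤ ‖Y σ‖ := by
    by_contra hcon
    push Not at hcon
    apply hx₁good
    refine ⟨hx₁c, Y, hY0, fun t ht => ?_, fun t ht => (hcon t ht).le⟩
    have hd := hYd t
    rw [hWeq _ (by linarith [hcon t ht])] at hd
    exact hd
  obtain ⟨σ₀, hσ₀, hσ₀R⟩ := hreach
  have hlt0 : (fun t => ‖Y t‖) 0 < Rout := by
    show ‖Y 0‖ < Rout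
    rw [hY0]; linarith
  obtain ⟨σ₁, hσ₁pos, -, hhit, hinside⟩ :=
    exists_first_hit (f := fun t => ‖Y t‖) hσ₀ hYc.norm.continuousOn hlt0 hσ₀R
  -- on `[0, σ₁]` the orbit is a true `W`-arc
  have hYV : ∀ t ∈ Icc 0 σ₁, HasDerivAt Y (-(W (Y t))) t := by
    intro t ht
    have hd := hYd t
    rw [neg_one_smul, hWeq _ (by linarith [hinside t ht])] at hd
    exact hd
  -- vortical along the arc
  have hvort : ∀ t ∈ Icc 0 σ₁, curl V (Y t) ≠ 0 := fun t ht =>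
    curl_ne_zero_of_arc hprof ht.1 (fun s hs => hYV s ⟨hs.1, hs.2.trans ht.2⟩) (by rw [hY0]; exact hx₁c)
  -- Bernoulli monotone along the arc, and the ACTION BUDGET
  have hmono : ∀ t ∈ Icc 0 σ₁, ℋ (Y 0) ≤ ℋ (Y t) := by
    intro t ht
    have e := bernoulli_arc hprof hYV le_rfl ht.1 ht.2
    have hI : 0 ≤ ∫ s in (0 : ℝ)..t, ‖selfSimilarTransport γ 0 V (Y s)‖ ^ 2 :=
      intervalIntegral.integral_nonneg ht.1 fun s _ => sq_nonneg _
    have : 0 ≤ ℋ (Y t) - ℋ (Y 0) := by rw [hHdef, e]; exact mul_nonneg h12.le hI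
    linarith
  have haction : (1 - 2 * γ) * ∫ s in (0 : ℝ)..σ₁, ‖W (Y s)‖ ^ 2 < δ' := by
    have e := bernoulli_arc hprof hYV le_rfl hσ₁pos.le le_rfl
    have h1 : ℋ (Y σ₁) ≤ Mb := hMb _ (hvort σ₁ ⟨hσ₁pos.le, le_rfl⟩)
    have h2 : Mb - δ' < ℋ (Y 0) := by rw [hY0]; exact hx₁H
    rw [hWdef, ← e]
    linarith
  -- ### the last crossing of `‖·‖ = R_in + 1` before `σ₁`: first hit of the REVERSED arc
  set g : ℝ → ℝ := fun s => -‖Y (σ₁ - s)‖ with hgdef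
  have hgc : ContinuousOn g (Icc 0 σ₁) :=
    ((hYc.comp (continuous_const.sub continuous_id)).norm.neg).continuousOn
  have hg0 : g 0 < -(Rin + 1) := by
    simp only [hgdef, sub_zero]
    have : ‖Y σ₁‖ = Rout := hhit
    rw [this, hRoutdef]; linarith
  have hgσ₁ : -(Rin + 1) ≤ g σ₁ := by
    simp only [hgdef, sub_self, hY0]
    linarith
  obtain ⟨s₁, hs₁pos, hs₁le, hs₁hit, hs₁in⟩ := exists_first_hit (f := g) hσ₁pos.le hgc hg0 hgσ₁
  set ta : ℝ := σ₁ - s₁ with htadef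
  have hta0 : 0 ≤ ta := by rw [htadef]; linarith
  have htaσ : ta ≤ σ₁ := by rw [htadef]; linarith
  have hYta : ‖Y ta‖ = Rin + 1 := by
    have : g s₁ = -(Rin + 1) := hs₁hit
    simp only [hgdef] at this
    rw [htadef]; linarith
  have hfar : ∀ t ∈ Icc ta σ₁, Rin + 1 ≤ ‖Y t‖ := by
    intro t ht
    have hs : σ₁ - t ∈ Icc 0 s₁ := ⟨by linarith [ht.2], by rw [htadef] at ht; linarith [ht.1]⟩
    have h := hs₁in (σ₁ - t) hs
    simp only [hgdef, sub_sub_cancel] at h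
    linarith
  -- ### the slowest point of the excursion `[t_a, σ₁]`
  have hWYc : Continuous fun t => ‖W (Y t)‖ := (hWc.comp hYc).norm
  obtain ⟨tm, htm, hmin⟩ := (isCompact_Icc (a := ta) (b := σ₁)).exists_isMinOn (nonempty_Icc.2 htaσ) hWYc.continuousOn
  set m : ℝ := ‖W (Y tm)‖ with hmdef
  have hm0 : 0 ≤ m := norm_nonneg _
  have hmle : ∀ t ∈ Icc ta σ₁, m ≤ ‖W (Y t)‖ := fun t ht => hmin ht
  -- length of the excursion: `1 ≤ ∫_{t_a}^{σ₁} ‖W(Y)‖`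
  have hint1 : IntervalIntegrable (fun t => ‖W (Y t)‖) volume ta σ₁ := hWYc.intervalIntegrable _ _
  have hint2 : IntervalIntegrable (fun t => ‖W (Y t)‖ ^ 2) volume ta σ₁ := (hWYc.pow 2).intervalIntegrable _ _
  have hlen : 1 ≤ ∫ t in ta..σ₁, ‖W (Y t)‖ := by
    have hftc : ∫ t in ta..σ₁, -(W (Y t)) = Y σ₁ - Y ta :=
      intervalIntegral.integral_eq_sub_of_hasDerivAt
        (fun t ht => by
          rw [uIcc_of_le htaσ] at ht
          exact hYV t ⟨hta0.trans ht.1, ht.2⟩)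
        ((hWc.comp hYc).neg.intervalIntegrable _ _)
    have h1 : ‖Y σ₁ - Y ta‖ ≤ ∫ t in ta..σ₁, ‖-(W (Y t))‖ := by
      rw [← hftc]; exact intervalIntegral.norm_integral_le_integral_norm htaσ
    simp only [norm_neg] at h1
    have h2 : ‖Y σ₁‖ - ‖Y ta‖ ≤ ‖Y σ₁ - Y ta‖ := norm_sub_norm_le _ _
    have h3 : ‖Y σ₁‖ = Rout := hhit
    rw [h3, hYta, hRoutdef] at h2
    linarith
  -- `m ∫‖W‖ ≤ ∫‖W‖² ≤ ∫₀^{σ₁}‖W‖² < δ′/(1−2γ)`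
  have hmint : m * ∫ t in ta..σ₁, ‖W (Y t)‖ ≤ ∫ t in ta..σ₁, ‖W (Y t)‖ ^ 2 := by
    rw [← intervalIntegral.integral_const_mul]
    refine intervalIntegral.integral_mono_on htaσ (hint1.const_mul m) hint2 fun t ht => ?_
    have h := hmle t ht
    nlinarith [norm_nonneg (W (Y t))]
  have hsub : ∫ t in ta..σ₁, ‖W (Y t)‖ ^ 2 ≤ ∫ t in (0 : ℝ)..σ₁, ‖W (Y t)‖ ^ 2 :=
    intervalIntegral.integral_mono_interval hta0 htaσ le_rfl
      (Eventually.of_forall fun t => sq_nonneg _) ((hWYc.pow 2).intervalIntegrable _ _)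
  have hm : m ≤ δ := by
    have h1 : m ≤ m * ∫ t in ta..σ₁, ‖W (Y t)‖ := le_mul_of_one_le_right hm0 hlen
    have h2 : (1 - 2 * γ) * m < δ' := by
      have := mul_le_mul_of_nonneg_left (h1.trans (hmint.trans hsub)) h12.le
      linarith
    nlinarith
  -- ### the creeping point
  have htm0 : tm ∈ Icc 0 σ₁ := ⟨hta0.trans htm.1, htm.2⟩
  refine ⟨Y tm, ?_, hvort tm htm0, ?_, hm⟩
  · exact hR₀Rin.trans ((by linarith : Rin ≤ Rin + 1).trans (hfar tm htm))
  · have h1 := hmono tm htm0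
    rw [hY0] at h1
    exact lt_of_lt_of_le (by linarith [hx₁H]) h1

end ActionCreep

end Summit.NavierStokesRegularity.NavierStokesRegularity.Theorems.PowerGaugeEulerLiouville

end
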